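import Summits.Ventures.PercRepro.Night2FatXStructure

/-!
# night-2: the capacity floor `vCap` — the full layer-0 capacity where the complement has rank `≤ 3`

The typed floor `vType` uses `capS ≥ 11/18` at every target; the truth is `capS T = 1` unless `T ∖ K` is
itself a layer-0 member, which needs `rk (G ∖ T) ≥ 4` (`gr ∖ (T ∖ K) = (G ∖ T) ∪ {e₀} ∪ (gr ∖ G)` must have
rank `7`).  So `k1 T = 0` and `capS T = 1` whenever `rk (G ∖ T) ≤ 3` (`k1_eq_zero_of_rkN_sdiff_le_three`,
`capS_eq_one_of_rkN_sdiff_le_three`) — in particular on the nested-line geometries, where the points of `G`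
off a target mostly lie on one line.  `vCap T = 1 / max 0 (capS T − L1 T) / 0` (top / unloaded / loaded) is a
floor of `cap3` at least `vType` (`vCap_le_cap3`, `vType_le_vCap`), and the face criterion holds with `vCap` in
place of `vType` on any sub-family of the targets (`basis_pair_fair_of_floor_face_sum_subfamily`,
`basis_pair_fair_of_vCap_face_sum_subfamily`).  Paper `proofs/NIGHT-2-g32.md` §3 (numerics: the level-`≤ 2`
criterion rises from `1.10` to `1.80` on the nested-line instances with `vCap`).
-/

namespace PercRepro.Shadow

open PercRepro.ThmH PercRepro.PerFlat

variable {α : Type*} [DecidableEq α] {M : Matroid α} [M.Finite] {G : Finset α}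

/-- **No layer-0 covering preimage when the complement has rank `≤ 3`**: a layer-0 preimage `B` of `T` has
`gr ∖ B ⊆ (G ∖ T) ∪ {z} ∪ (gr ∖ G)`, of rank `≤ 3 + 1 + 2 < 7`. -/
theorem k1_eq_zero_of_rkN_sdiff_le_three (hd : (gr M \ G).card = 2) {T : Finset α}
    (hr : rkN M (G \ T) ≤ 3) : k1 M 5 G T = 0 := by
  unfold k1
  rw [Finset.card_eq_zero, Finset.filter_eq_empty_iff]
  intro B hB _
  rw [mem_coverPreimages] at hB
  obtain ⟨hBm, hcov⟩ := hB
  obtain ⟨z, hz, rfl⟩ := mem_coverSets.1 hcov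
  have hBU : B ∈ Uq M (5 + 2) 5 := (mem_membersIn.1 hBm).1
  have h7 := rkN_sdiff_eq_of_mem_Uq hBU
  have hsub : gr M \ B ⊆ ((G \ insert z B) ∪ {z}) ∪ (gr M \ G) := by
    intro e he
    rw [Finset.mem_sdiff] at he
    rw [Finset.mem_union, Finset.mem_union, Finset.mem_sdiff, Finset.mem_singleton, Finset.mem_sdiff,
      Finset.mem_insert]
    by_cases heG : e ∈ G
    · by_cases hez : e = z
      · exact Or.inl (Or.inr hez)
      · exact Or.inl (Or.inl ⟨heG, fun h => h.elim hez he.2⟩)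
    · exact Or.inr ⟨he.1, heG⟩
  have h1 := rkN_mono (M := M) hsub
  have h2 := rkN_union_le_add_card (M := M) ((G \ insert z B) ∪ {z}) (gr M \ G)
  have h3 := rkN_union_le_add_card (M := M) (G \ insert z B) {z}
  rw [hd] at h2
  rw [Finset.card_singleton] at h3
  omega

/-- **`capS T = 1` when the complement of `T` in `G` has rank `≤ 3`.** -/
theorem capS_eq_one_of_rkN_sdiff_le_three (hd : (gr M \ G).card = 2) {T : Finset α}
    (hr : rkN M (G \ T) ≤ 3) : capS M 5 G T = 1 := by
  unfold capS
  rw [k1_eq_zero_of_rkN_sdiff_le_three hd hr]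
  simp

/-- The capacity floor with the exact layer-0 capacity: `1` when at most one point of `G` is off `T`;
`max 0 (capS T − L1 T)` at an unloaded target; `0` at a loaded one. -/
noncomputable def vCap (M : Matroid α) [M.Finite] (G T : Finset α) : ℚ :=
  if (G \ T).card ≤ 1 then 1
  else if dload M 5 G (bigP M G) (dshGT2 M 5 G) T = 0 then max 0 (capS M 5 G T - L1 M 5 G T)
  else 0

/-- `vCap` is nonnegative. -/
theorem vCap_nonneg (T : Finset α) : 0 ≤ vCap M G T := by
  unfold vCap
  split_ifs
  · norm_num
  · exact le_max_left _ _
  · exact le_refl _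

/-- `vType ≤ vCap` (`capS ≥ 11/18`). -/
theorem vType_le_vCap (hd : (gr M \ G).card = 2) (hk : kColoops M G = 1) {T : Finset α} (hTG : T ⊆ G) :
    vType M G T ≤ vCap M G T := by
  have hcap := capS_ge_eleven_eighteenths_two_one hd hk hTG
  unfold vType vCap
  split_ifs
  · exact le_refl _
  · apply max_le (le_max_left _ _)
    refine le_trans ?_ (le_max_right _ _)
    linarith
  · exact le_refl _

/-- **`vCap` is a floor of `cap3`.** -/
theorem vCap_le_cap3 (hG : G ∈ flatsQ M (5 + 1)) (hd : (gr M \ G).card = 2) (hk : kColoops M G = 1)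
    (hs : ∀ e ∈ gr M, ∀ f ∈ gr M, e ≠ f → rkN M {e, f} = 2) (hl : ∀ e ∈ gr M, M.Indep {e})
    (hfat : (fatClosures M 5 G 2).card ≤ 1) {T : Finset α} (hTG : T ⊆ G) (hKT : coloops M G ⊆ T) :
    vCap M G T ≤ cap3 M 5 G (bigP M G) (dshGT2 M 5 G) T := by
  have hd' : (gr M \ G).card ≤ 5 := by omega
  have hcol := dload_gt2_le_cap2 hG hd hk hs hl hfat hTG hKT
  unfold vCap
  split_ifs with h1 h2
  · rw [cap3_gt2_eq_one_of_card_sdiff_le_one hG hd h1]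
  · unfold cap3
    rw [h2, sub_zero]
    have h4 := cap2_ge_capS_sub_L1_of_le hG hd' T
    rw [h2] at hcol
    exact max_le hcol h4
  · unfold cap3
    linarith

/-- **The basis pairs' fair share from an arbitrary floor of `cap3` and the face sums on a sub-family**:
`0 ≤ v ≤ cap3` at the targets of `𝒯 ⊆ tgtSets B z` and `1 ≤ Σ_{T ∈ 𝒯} v T / faceSum T`. -/
theorem basis_pair_fair_of_floor_face_sum_subfamily (hG : G ∈ flatsQ M (5 + 1)) (hd : (gr M \ G).card = 2)
    (hk : kColoops M G = 1) (hs : ∀ e ∈ gr M, ∀ f ∈ gr M, e ≠ f → rkN M {e, f} = 2)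
    (hl : ∀ e ∈ gr M, M.Indep {e}) (hfat : (fatClosures M 5 G 2).card ≤ 1)
    {B : Finset α} (hB : B ∈ thinMembers M 5 G) (hnP : ¬ bigP M G B) {z : α} (hz : z ∈ G \ clF M B)
    (hl0 : loss M 5 G B z ≠ 0) {𝒯 : Finset (Finset α)} (h𝒯 : 𝒯 ⊆ tgtSets M 5 G B z) (v : Finset α → ℚ)
    (hv0 : ∀ T ∈ 𝒯, 0 ≤ v T) (hv : ∀ T ∈ 𝒯, v T ≤ cap3 M 5 G (bigP M G) (dshGT2 M 5 G) T)
    (hsum : 1 ≤ ∑ T ∈ 𝒯, v T / faceSum M G T) :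
    loss M 5 G B z ≤ rhoL M 5 G B z * lossIncomeH M 5 G (bigP M G) (dshGT2 M 5 G) B z := by
  have hd' : (gr M \ G).card ≤ 5 := by omega
  have hB4 := card_sdiff_eq_four_of_not_bigP hG hd hk hB hnP
  set D : ℚ := ((2 ^ (G.card - 6) - 1 : ℕ) : ℚ) with hD
  have hDpos : 0 < D := by
    rw [hD]
    have h7 : 7 ≤ G.card := by
      have hKB : coloops M G ⊆ B := coloops_subset_of_mem_thinMembers hG hd' hB
      have hBG : B ⊆ G := subset_G_of_mem_thinMembers hB
      have h1 := Finset.card_sdiff_add_card_eq_card hKB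
      rw [← kColoops_eq_card_coloops, hk] at h1
      have h2 := two_le_card_sdiff_of_not_lay0 hG hd' (mem_thinMembers.1 hB).1 (mem_thinMembers.1 hB).2
      have hdisj : Disjoint B (G \ clF M B) := by
        rw [Finset.disjoint_left]
        intro a ha ha'
        exact (Finset.mem_sdiff.1 ha').2 (subset_clF_of_subset_gr (hBG.trans (mem_flatsQ.1 hG).1) ha)
      have h3 := Finset.card_le_card (Finset.union_subset hBG (Finset.sdiff_subset : G \ clF M B ⊆ G))
      rw [Finset.card_union_of_disjoint hdisj] at h3
      omega
    have : 2 ≤ 2 ^ (G.card - 6) := by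
      calc 2 = 2 ^ 1 := by norm_num
        _ ≤ 2 ^ (G.card - 6) := Nat.pow_le_pow_right (by norm_num) (by omega)
    exact_mod_cast (by omega : 0 < 2 ^ (G.card - 6) - 1)
  have hrho : rhoL M 5 G B z = loss M 5 G B z / D := by
    unfold rhoL
    rw [card_tgtSets hG (mem_thinMembers.1 hB).1 hz,
      card_sdiff_insert_eq_dqm1 (ρ := 5) hG hd' hB (by omega) hz, hk]
    have hcard : G.card - 1 - 5 = G.card - 6 := by omega
    rw [hcard]
  set u : Finset α → ℚ := fun T => faceSum M G T / D with hu
  have hmass : ∀ T ∈ 𝒯, pi2MassH M 5 G (bigP M G) T ≤ u T := fun T hT =>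
    pi2MassH_le_face_sum hG hd hk (subset_G_of_mem_shadowAt (mem_tgtSets.1 (h𝒯 hT)).1)
      (coloops_subset_of_mem_shadowAt (mem_tgtSets.1 (h𝒯 hT)).1)
  have hinc := lossIncomeH_ge_of_subfamily hG hd' (column_side_gt2 hG hd hk hs hl hfat) hB hnP hz hl0
    h𝒯 u v hmass hv hv0
  have hsplit : ∑ T ∈ 𝒯, v T / u T = D * ∑ T ∈ 𝒯, v T / faceSum M G T := by
    rw [Finset.mul_sum]
    apply Finset.sum_congr rfl
    intro T _
    simp only [hu]
    by_cases hc : faceSum M G T = 0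
    · rw [hc]
      simp
    · field_simp
  have hD' : D ≤ ∑ T ∈ 𝒯, v T / u T := by
    rw [hsplit]
    have := mul_le_mul_of_nonneg_left hsum hDpos.le
    linarith
  rw [hrho]
  have hloss0 : 0 ≤ loss M 5 G B z := loss_nonneg (le_trans (by norm_num)
    (capS_ge_eleven_eighteenths_two_one hd hk (Finset.insert_subset (Finset.mem_sdiff.1 hz).1
      (subset_G_of_mem_thinMembers hB))))
  calc loss M 5 G B z = loss M 5 G B z / D * D := by field_simp
    _ ≤ loss M 5 G B z / D * lossIncomeH M 5 G (bigP M G) (dshGT2 M 5 G) B z := by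
        apply mul_le_mul_of_nonneg_left (hD'.trans hinc)
        exact div_nonneg hloss0 hDpos.le

/-- **The basis pairs' fair share from `vCap` and the face sums on a sub-family of the targets.** -/
theorem basis_pair_fair_of_vCap_face_sum_subfamily (hG : G ∈ flatsQ M (5 + 1)) (hd : (gr M \ G).card = 2)
    (hk : kColoops M G = 1) (hs : ∀ e ∈ gr M, ∀ f ∈ gr M, e ≠ f → rkN M {e, f} = 2)
    (hl : ∀ e ∈ gr M, M.Indep {e}) (hfat : (fatClosures M 5 G 2).card ≤ 1)
    {B : Finset α} (hB : B ∈ thinMembers M 5 G) (hnP : ¬ bigP M G B) {z : α} (hz : z ∈ G \ clF M B)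
    (hl0 : loss M 5 G B z ≠ 0) {𝒯 : Finset (Finset α)} (h𝒯 : 𝒯 ⊆ tgtSets M 5 G B z)
    (hsum : 1 ≤ ∑ T ∈ 𝒯, vCap M G T / faceSum M G T) :
    loss M 5 G B z ≤ rhoL M 5 G B z * lossIncomeH M 5 G (bigP M G) (dshGT2 M 5 G) B z :=
  basis_pair_fair_of_floor_face_sum_subfamily hG hd hk hs hl hfat hB hnP hz hl0 h𝒯 (vCap M G)
    (fun _ _ => vCap_nonneg _)
    (fun _ hT => vCap_le_cap3 hG hd hk hs hl hfat (subset_G_of_mem_shadowAt (mem_tgtSets.1 (h𝒯 hT)).1)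
      (coloops_subset_of_mem_shadowAt (mem_tgtSets.1 (h𝒯 hT)).1)) hsum

/-- **The (2,1) cell of h21 from the `vCap` face sums alone.** -/
theorem localShadowHall_of_vCap_face_sums (hG : G ∈ flatsQ M (5 + 1)) (hd : (gr M \ G).card = 2)
    (hk : kColoops M G = 1) (hs : ∀ e ∈ gr M, ∀ f ∈ gr M, e ≠ f → rkN M {e, f} = 2)
    (hl : ∀ e ∈ gr M, M.Indep {e}) (hfat : (fatClosures M 5 G 2).card ≤ 1)
    (hsum : ∀ B ∈ thinMembers M 5 G, ¬ bigP M G B → ∀ z ∈ G \ clF M B, loss M 5 G B z ≠ 0 →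
      1 ≤ ∑ T ∈ tgtSets M 5 G B z, vCap M G T / faceSum M G T) :
    LocalShadowHall M 5 G := by
  apply localShadowHall_of_gt2_of_basis_fair hG hd hk hs hl hfat
  intro B hB hnP z hz
  by_cases hl0 : loss M 5 G B z = 0
  · rw [hl0]
    have hd' : (gr M \ G).card ≤ 5 := by omega
    have h1 : 0 ≤ rhoL M 5 G B z := by
      unfold rhoL
      rw [hl0]
      simp
    have h2 : 0 ≤ lossIncomeH M 5 G (bigP M G) (dshGT2 M 5 G) B z :=
      lossIncomeH_nonneg hG hd' (column_side_gt2 hG hd hk hs hl hfat) B z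
    positivity
  · exact basis_pair_fair_of_vCap_face_sum_subfamily hG hd hk hs hl hfat hB hnP hz hl0
      (Finset.Subset.refl _) (hsum B hB hnP z hz hl0)

end PercRepro.Shadow
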